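import Summits.KontsevichZagierPeriods.KontsevichZagierPeriods.Theses.SymplecticScissors
import Summits.KontsevichZagierPeriods.KontsevichZagierPeriods.Theorems.PlanarK0Injective.Negative.Kit
import Summits.KontsevichZagierPeriods.KontsevichZagierPeriods.Theorems.PlanarAreas.Negative.Normalisations
import Literature.NumberTheory.Transcendental.KZSemiCanonicalReductionProofs
import Literature.NumberTheory.Transcendental.KZSemiCanonicalReductionDimOne
import Literature.NumberTheory.Transcendental.SemialgebraicMapsProofs
import Literature.NumberTheory.Transcendental.KZLogCalculusProofs
import Literature.NumberTheory.Transcendental.SemialgebraicMonotonicityDefinable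

/-!
# `PlanarCompiler`, stub `stub_elementaryMoves` — helper file I: bookkeeping in the planar set-chain group

Crux stmt-KontsevichZagierPeriods-10058 (route SymplecticScissors), line `twist-restoring-shear`.
Bookkeeping lemmas for the planar set-chain group
`G = closure((domainAddRel ∪ changeOfVariablesRel) ∩ closure{[s] : s planar, integrand 1})`
(`planarGroup` of the kit `PlanarK0Injective.Negative.Kit`), all stated for integrand-`1` planar
representations with prescribed domains:

* §1 restriction, one cut, null modifications, finite almost-partitions
  (`of_sub_sum_mem_planarGroup`, the planar copy of `KZ.of_sub_sum_of_mem_relations`);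
* §2 a rule-2 instance with `|det| = 1` between integrand-`1` representations is in `G`, preserves
  area (`volume_image_eq_of_abs_det_eq_one`), and its image carries an integrand-`1` representation;
* §3 cylinders, open bands `{x ∈ P, a x < y < b x}` and graphs over subsets `P` of the line;
* §4 null `ℚ`-semialgebraic subsets of the line are finite; `1 × 1` determinants.

Registered sub-goal: `stub_elementaryMoves_nullModification` (null modifications of integrand-`1`
planar representations lie in `G`).
-/

noncomputable section

open MeasureTheory Set
open Literature.NumberTheory.Transcendental Literature.ModelTheory.ExponentialFields
open Summit.KontsevichZagierPeriods.KontsevichZagierPeriods.Theses.SymplecticScissors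
open Summit.KontsevichZagierPeriods.SymplecticScissors.PlanarK0InjectiveNegative
open Summit.KontsevichZagierPeriods.PlanarAreas.Negative (volume_lt_top_of_integrand_one)

namespace Summit.KontsevichZagierPeriods.SymplecticScissors.PlanarCompilerProof.ElementaryMoves

/-! ## §1 Finite area, cuts, null modifications, finite almost-partitions -/

/-- A restriction of an integrand-`1` representation has integrand `1` on its domain. [folklore] -/
theorem restrict_one {n : ℕ} (r : KZ.IntegralRep n) (hr : ∀ p ∈ r.domain, r.integrand p = 1)
    (s : Set (Fin n → ℝ)) (hs : IsSemialgebraic ℚ s) (hsr : s ⊆ r.domain) :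
    ∀ p ∈ (r.restrict s hs hsr).domain, (r.restrict s hs hsr).integrand p = 1 :=
  fun p hp => hr p (hsr hp)

/-- An integrand-`1` planar representation is a planar generator. [folklore] -/
theorem of_mem_closure_planarGens (r : KZ.IntegralRep 2) (hr : ∀ p ∈ r.domain, r.integrand p = 1) :
    KZ.of r ∈ AddSubgroup.closure planarGens :=
  AddSubgroup.subset_closure ⟨r, hr, rfl⟩

/-- One cut: a planar rule-1a instance among integrand-`1` representations lies in `G`. [folklore] -/
theorem cut_mem_planarGroup (r r₁ r₂ : KZ.IntegralRep 2) (hr : ∀ p ∈ r.domain, r.integrand p = 1)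
    (hr₁ : ∀ p ∈ r₁.domain, r₁.integrand p = 1) (hr₂ : ∀ p ∈ r₂.domain, r₂.integrand p = 1)
    (hdom : r.domain = r₁.domain ∪ r₂.domain) (h0 : volume (r₁.domain ∩ r₂.domain) = 0) :
    KZ.of r - KZ.of r₁ - KZ.of r₂ ∈ planarGroup := by
  refine AddSubgroup.subset_closure ⟨Or.inl ⟨2, r, r₁, r₂, hdom, h0, fun p hp => ?_, fun p hp => ?_,
    rfl⟩, ?_⟩
  · rw [hr₁ p hp, hr p (hdom ▸ Or.inl hp)]
  · rw [hr₂ p hp, hr p (hdom ▸ Or.inr hp)]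
  · exact sub_mem (sub_mem (of_mem_closure_planarGens r hr) (of_mem_closure_planarGens r₁ hr₁))
      (of_mem_closure_planarGens r₂ hr₂)

/-- A planar rule-2 instance among integrand-`1` representations lies in `G`. [folklore] -/
theorem mem_planarGroup_of_mem_cov (r r' : KZ.IntegralRep 2) (hr : ∀ p ∈ r.domain, r.integrand p = 1)
    (hr' : ∀ p ∈ r'.domain, r'.integrand p = 1) (h : KZ.of r - KZ.of r' ∈ KZ.changeOfVariablesRel) :
    KZ.of r - KZ.of r' ∈ planarGroup :=
  AddSubgroup.subset_closure ⟨Or.inr h, sub_mem (of_mem_closure_planarGens r hr)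
    (of_mem_closure_planarGens r' hr')⟩

/-- Removing a null part of the domain does not change the class in `G`. [folklore] -/
theorem sub_mem_planarGroup_of_subset (r r' : KZ.IntegralRep 2)
    (hr : ∀ p ∈ r.domain, r.integrand p = 1) (hr' : ∀ p ∈ r'.domain, r'.integrand p = 1)
    (hsub : r'.domain ⊆ r.domain) (h0 : volume (r.domain \ r'.domain) = 0) :
    KZ.of r - KZ.of r' ∈ planarGroup := by
  have hD : IsSemialgebraic ℚ (r.domain \ r'.domain) :=
    r.isSemialgebraic_domain.diff r'.isSemialgebraic_domain
  obtain ⟨d, hdd, hdi⟩ := KZ.exists_oneRep hD (by rw [h0]; exact ENNReal.zero_ne_top)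
  have hd1 : ∀ p ∈ d.domain, d.integrand p = 1 := fun p _ => by rw [hdi]
  have hcut : KZ.of r - KZ.of r' - KZ.of d ∈ planarGroup :=
    cut_mem_planarGroup r r' d hr hr' hd1 (by rw [hdd, Set.union_sdiff_cancel hsub])
      (by rw [hdd, Set.inter_sdiff_self, measure_empty])
  have hnull : KZ.of d ∈ planarGroup := of_mem_planarGroup_of_volume_eq_zero d hd1 (hdd ▸ h0)
  have : KZ.of r - KZ.of r' = (KZ.of r - KZ.of r' - KZ.of d) + KZ.of d := by abel
  rw [this]
  exact add_mem hcut hnull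

/-- **Null modifications**: two integrand-`1` planar representations whose domains differ by null
sets are congruent modulo `G`. [folklore] -/
theorem sub_mem_planarGroup_of_null (r r' : KZ.IntegralRep 2)
    (hr : ∀ p ∈ r.domain, r.integrand p = 1) (hr' : ∀ p ∈ r'.domain, r'.integrand p = 1)
    (h₁ : volume (r.domain \ r'.domain) = 0) (h₂ : volume (r'.domain \ r.domain) = 0) :
    KZ.of r - KZ.of r' ∈ planarGroup := by
  have hI : IsSemialgebraic ℚ (r.domain ∩ r'.domain) :=
    r.isSemialgebraic_domain.inter r'.isSemialgebraic_domain
  have hfin : volume (r.domain ∩ r'.domain) ≠ ⊤ :=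
    ((measure_mono inter_subset_left).trans_lt (volume_lt_top_of_integrand_one r hr)).ne
  obtain ⟨i, hid, hii⟩ := KZ.exists_oneRep hI hfin
  have hi1 : ∀ p ∈ i.domain, i.integrand p = 1 := fun p _ => by rw [hii]
  have e1 : KZ.of r - KZ.of i ∈ planarGroup :=
    sub_mem_planarGroup_of_subset r i hr hi1 (hid ▸ inter_subset_left) (by rwa [hid, Set.sdiff_self_inter])
  have e2 : KZ.of r' - KZ.of i ∈ planarGroup :=
    sub_mem_planarGroup_of_subset r' i hr' hi1 (hid ▸ inter_subset_right)
      (by rwa [hid, inter_comm, Set.sdiff_self_inter])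
  have : KZ.of r - KZ.of r' = (KZ.of r - KZ.of i) - (KZ.of r' - KZ.of i) := by abel
  rw [this]
  exact sub_mem e1 e2

/-- **Iterated cuts over a finite almost-partition** (planar copy of
`KZ.of_sub_sum_of_mem_relations`): if the domains of the integrand-`1` representations `Rᵢ`
(`i ∈ s`) lie in the domain of `r` up to null sets, pairwise meet in null sets and cover the domain
of `r` up to a null set, then `[r] − ∑ᵢ [Rᵢ] ∈ G`. [folklore] -/
theorem of_sub_sum_mem_planarGroup {ι : Type*} (s : Finset ι) :
    ∀ (r : KZ.IntegralRep 2) (R : ι → KZ.IntegralRep 2), (∀ p ∈ r.domain, r.integrand p = 1) →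
      (∀ i ∈ s, ∀ p ∈ (R i).domain, (R i).integrand p = 1) →
      (∀ i ∈ s, volume ((R i).domain \ r.domain) = 0) →
      volume (r.domain \ ⋃ i ∈ s, (R i).domain) = 0 →
      (s : Set ι).Pairwise (fun i j => volume ((R i).domain ∩ (R j).domain) = 0) →
      KZ.of r - ∑ i ∈ s, KZ.of (R i) ∈ planarGroup := by
  classical
  induction s using Finset.induction_on with
  | empty =>
    intro r R hr _ _ hcov _
    simp only [Finset.notMem_empty, iUnion_of_empty, iUnion_empty, Set.sdiff_empty] at hcov
    simpa using of_mem_planarGroup_of_volume_eq_zero r hr hcov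
  | insert a s ha ih =>
    intro r R hr hR hdom hcov hdisj
    have hA : IsSemialgebraic ℚ (r.domain ∩ (R a).domain) :=
      r.isSemialgebraic_domain.inter (R a).isSemialgebraic_domain
    have hB : IsSemialgebraic ℚ (r.domain \ (R a).domain) :=
      r.isSemialgebraic_domain.diff (R a).isSemialgebraic_domain
    set r₁ := r.restrict _ hA inter_subset_left with hr₁
    set r₂ := r.restrict _ hB Set.sdiff_subset with hr₂
    have hr₁1 : ∀ p ∈ r₁.domain, r₁.integrand p = 1 := restrict_one r hr _ hA inter_subset_left
    have hr₂1 : ∀ p ∈ r₂.domain, r₂.integrand p = 1 := restrict_one r hr _ hB Set.sdiff_subset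
    have hRa1 := hR a (Finset.mem_insert_self a s)
    have hsplit : KZ.of r - KZ.of r₁ - KZ.of r₂ ∈ planarGroup :=
      cut_mem_planarGroup r r₁ r₂ hr hr₁1 hr₂1 (by simp [hr₁, hr₂])
        (by rw [show r₁.domain ∩ r₂.domain = ∅ from
          eq_empty_of_forall_notMem fun x hx => hx.2.2 hx.1.2, measure_empty])
    have h₁ : KZ.of r₁ - KZ.of (R a) ∈ planarGroup := by
      refine sub_mem_planarGroup_of_null r₁ (R a) hr₁1 hRa1 ?_ ?_
      · simp [hr₁, Set.sdiff_eq_empty.mpr inter_subset_right]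
      · have : (R a).domain \ r₁.domain = (R a).domain \ r.domain := by simp [hr₁]
        rw [this]
        exact hdom a (Finset.mem_insert_self a s)
    have h₂ : KZ.of r₂ - ∑ i ∈ s, KZ.of (R i) ∈ planarGroup := by
      refine ih r₂ R hr₂1 (fun i hi => hR i (Finset.mem_insert_of_mem hi)) (fun i hi => ?_) ?_ ?_
      · have hsub : (R i).domain \ r₂.domain ⊆ ((R i).domain \ r.domain) ∪
            ((R i).domain ∩ (R a).domain) := by
          intro x hx
          by_cases hxr : x ∈ r.domain
          · exact Or.inr ⟨hx.1, by_contra fun h => hx.2 ⟨hxr, h⟩⟩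
          · exact Or.inl ⟨hx.1, hxr⟩
        exact measure_mono_null hsub (measure_union_null (hdom i (Finset.mem_insert_of_mem hi))
          (hdisj (Finset.mem_insert_of_mem hi) (Finset.mem_insert_self a s)
            (fun h => ha (h ▸ hi))))
      · have : r₂.domain \ ⋃ i ∈ s, (R i).domain =
            r.domain \ ⋃ i ∈ insert a s, (R i).domain := by
          rw [Finset.set_biUnion_insert, hr₂, KZ.IntegralRep.domain_restrict, Set.sdiff_sdiff]
        rw [this]
        exact hcov
      · exact hdisj.mono (Finset.coe_subset.mpr (Finset.subset_insert a s))
    rw [Finset.sum_insert ha]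
    have : KZ.of r - (KZ.of (R a) + ∑ i ∈ s, KZ.of (R i)) =
        (KZ.of r - KZ.of r₁ - KZ.of r₂) + (KZ.of r₁ - KZ.of (R a)) +
          (KZ.of r₂ - ∑ i ∈ s, KZ.of (R i)) := by abel
    rw [this]
    exact add_mem (add_mem hsplit h₁) h₂

/-! ## §2 Rule-2 instances with `|det| = 1` -/

/-- An injective map with a derivative of determinant `±1` along a measurable set preserves its
volume (`lintegral_abs_det_fderiv_eq_addHaar_image`). [folklore] -/
theorem volume_image_eq_of_abs_det_eq_one {S : Set (Fin 2 → ℝ)} (hS : MeasurableSet S)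
    {Ψ : (Fin 2 → ℝ) → (Fin 2 → ℝ)} {Ψ' : (Fin 2 → ℝ) → (Fin 2 → ℝ) →L[ℝ] (Fin 2 → ℝ)}
    (hd : ∀ x ∈ S, HasFDerivWithinAt Ψ (Ψ' x) S x) (hinj : InjOn Ψ S)
    (hdet : ∀ x ∈ S, |(Ψ' x).det| = 1) : volume (Ψ '' S) = volume S := by
  rw [← lintegral_abs_det_fderiv_eq_addHaar_image volume hS hd hinj]
  rw [setLIntegral_congr_fun hS (fun x hx => by rw [hdet x hx])]
  simp

/-- The image of the domain of an integrand-`1` planar representation under a `ℚ`-semialgebraic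
injective map with `|det| = 1` carries an integrand-`1` representation (Tarski–Seidenberg image,
area preserved). [folklore] -/
theorem exists_rep_image (r : KZ.IntegralRep 2) (hr : ∀ p ∈ r.domain, r.integrand p = 1)
    {Ψ : (Fin 2 → ℝ) → (Fin 2 → ℝ)} {Ψ' : (Fin 2 → ℝ) → (Fin 2 → ℝ) →L[ℝ] (Fin 2 → ℝ)}
    (hΨ : IsSemialgebraicMapOn ℚ r.domain Ψ) (hd : ∀ x ∈ r.domain, HasFDerivWithinAt Ψ (Ψ' x) r.domain x)
    (hinj : InjOn Ψ r.domain) (hdet : ∀ x ∈ r.domain, |(Ψ' x).det| = 1) :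
    ∃ r' : KZ.IntegralRep 2, r'.domain = Ψ '' r.domain ∧ r'.integrand = fun _ => 1 := by
  refine KZ.exists_oneRep
    (IsSemialgebraicMapOn.isSemialgebraic_image_holds hΨ Subset.rfl r.isSemialgebraic_domain) ?_
  rw [volume_image_eq_of_abs_det_eq_one (KZ.IntegralRep.measurableSet_domain_holds r) hd hinj hdet]
  exact (volume_lt_top_of_integrand_one r hr).ne

/-- A `ℚ`-semialgebraic injective map with `|det| = 1` on the domain of an integrand-`1` planar
representation, onto the domain of another one, is a planar rule-2 instance in `G`. [folklore] -/
theorem sub_mem_planarGroup_of_map (r r' : KZ.IntegralRep 2) (hr : ∀ p ∈ r.domain, r.integrand p = 1)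
    (hr' : ∀ p ∈ r'.domain, r'.integrand p = 1)
    {Ψ : (Fin 2 → ℝ) → (Fin 2 → ℝ)} {Ψ' : (Fin 2 → ℝ) → (Fin 2 → ℝ) →L[ℝ] (Fin 2 → ℝ)}
    (hΨ : IsSemialgebraicMapOn ℚ r.domain Ψ) (hd : ∀ x ∈ r.domain, HasFDerivWithinAt Ψ (Ψ' x) r.domain x)
    (hinj : InjOn Ψ r.domain) (hdet : ∀ x ∈ r.domain, |(Ψ' x).det| = 1)
    (hdom : r'.domain = Ψ '' r.domain) : KZ.of r - KZ.of r' ∈ planarGroup := by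
  refine mem_planarGroup_of_mem_cov r r' hr hr' ⟨2, r, r', Ψ, Ψ', hΨ, hd, hinj, hdom, fun x hx => ?_, rfl⟩
  rw [hr x hx, hr' _ (hdom ▸ mem_image_of_mem Ψ hx), hdet x hx, one_mul]

/-! ## §3 Cylinders, open bands and graphs over subsets of the line -/

/-- The base point of a point of the plane: `Fin.init p` is the constant `p 0`. [folklore] -/
theorem init_eq (p : Fin 2 → ℝ) : Fin.init p = fun _ : Fin 1 => p 0 := by
  funext i
  fin_cases i
  rfl

/-- A point of the plane in terms of its two coordinates. [folklore] -/
theorem eq_vec (p : Fin 2 → ℝ) : p = ![p 0, p 1] := by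
  funext i
  fin_cases i <;> rfl

/-- The cylinder over a `ℚ`-semialgebraic subset of the line is `ℚ`-semialgebraic. [folklore] -/
theorem isSemialgebraic_cyl {P : Set (Fin 1 → ℝ)} (hP : IsSemialgebraic ℚ P) :
    IsSemialgebraic ℚ {p : Fin 2 → ℝ | (fun _ : Fin 1 => p 0) ∈ P} :=
  hP.preimage_comp (fun _ : Fin 1 => (0 : Fin 2))

/-- The cylinder over a null subset of the line is null. [folklore] -/
theorem volume_cyl_eq_zero {E : Set (Fin 1 → ℝ)} (hE : volume E = 0) :
    volume {p : Fin 2 → ℝ | (fun _ : Fin 1 => p 0) ∈ E} = 0 := by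
  have h := KZ.volume_setOf_init_mem_eq_zero (n := 1) hE
  simpa only [init_eq] using h

/-- A subset of the plane whose base points lie in a null subset of the line is null. [folklore] -/
theorem volume_eq_zero_of_base {S : Set (Fin 2 → ℝ)} {E : Set (Fin 1 → ℝ)} (hE : volume E = 0)
    (hS : S ⊆ {p : Fin 2 → ℝ | (fun _ : Fin 1 => p 0) ∈ E}) : volume S = 0 :=
  measure_mono_null hS (volume_cyl_eq_zero hE)

/-- A `ℚ`-semialgebraic function of the base, seen on a `ℚ`-semialgebraic subset of the cylinder.
[folklore] -/
theorem isSemialgebraicFunOn_base {P : Set (Fin 1 → ℝ)} {u : (Fin 1 → ℝ) → ℝ}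
    (hu : IsSemialgebraicFunOn ℚ P u) {B : Set (Fin 2 → ℝ)} (hB : IsSemialgebraic ℚ B)
    (hBP : B ⊆ {p : Fin 2 → ℝ | (fun _ : Fin 1 => p 0) ∈ P}) :
    IsSemialgebraicFunOn ℚ B (fun p => u (fun _ : Fin 1 => p 0)) := by
  have h := hu.comp_init_mono hB (fun p hp => by simpa only [mem_setOf_eq, init_eq] using hBP hp)
  simpa only [init_eq] using h

/-- Open bands `{x ∈ P, a x < y < b x}` with `ℚ`-semialgebraic edges are `ℚ`-semialgebraic
(graph elimination, Tarski–Seidenberg). [folklore] -/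
theorem isSemialgebraic_band {P : Set (Fin 1 → ℝ)} {a b : (Fin 1 → ℝ) → ℝ}
    (ha : IsSemialgebraicFunOn ℚ P a) (hb : IsSemialgebraicFunOn ℚ P b) :
    IsSemialgebraic ℚ {p : Fin 2 → ℝ | (fun _ : Fin 1 => p 0) ∈ P ∧ a (fun _ : Fin 1 => p 0) < p 1 ∧
      p 1 < b (fun _ : Fin 1 => p 0)} := by
  have hTa : IsSemialgebraic ℚ {u : Fin 3 → ℝ | u 2 < u 1} := by
    simpa using isSemialgebraic_setOf_eval_lt (k := ℚ) (R := ℝ) (ι := Fin 3)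
      (MvPolynomial.X 2) (MvPolynomial.X 1)
  have hTb : IsSemialgebraic ℚ {u : Fin 3 → ℝ | u 1 < u 2} := by
    simpa using isSemialgebraic_setOf_eval_lt (k := ℚ) (R := ℝ) (ι := Fin 3)
      (MvPolynomial.X 1) (MvPolynomial.X 2)
  have hA := ha.isSemialgebraic_setOf_snoc_mem tarski_seidenberg_real_holds hTa
  have hBb := hb.isSemialgebraic_setOf_snoc_mem tarski_seidenberg_real_holds hTb
  convert hA.inter hBb using 1
  ext p
  simp only [mem_setOf_eq, mem_inter_iff, init_eq]
  have h1 : (Fin.snoc p (a fun _ : Fin 1 => p 0) : Fin 3 → ℝ) 2 = a fun _ => p 0 :=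
    Fin.snoc_last (α := fun _ => ℝ) _ _
  have h2 : (Fin.snoc p (a fun _ : Fin 1 => p 0) : Fin 3 → ℝ) 1 = p 1 :=
    Fin.snoc_castSucc (α := fun _ => ℝ) _ _ (1 : Fin 2)
  have h3 : (Fin.snoc p (b fun _ : Fin 1 => p 0) : Fin 3 → ℝ) 2 = b fun _ => p 0 :=
    Fin.snoc_last (α := fun _ => ℝ) _ _
  have h4 : (Fin.snoc p (b fun _ : Fin 1 => p 0) : Fin 3 → ℝ) 1 = p 1 :=
    Fin.snoc_castSucc (α := fun _ => ℝ) _ _ (1 : Fin 2)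
  rw [h1, h2, h3, h4]
  tauto

/-- The graph of a `ℚ`-semialgebraic function over a subset of the line is null. [folklore] -/
theorem volume_graph_eq_zero {P : Set (Fin 1 → ℝ)} {u : (Fin 1 → ℝ) → ℝ}
    (hu : IsSemialgebraicFunOn ℚ P u) :
    volume {p : Fin 2 → ℝ | (fun _ : Fin 1 => p 0) ∈ P ∧ p 1 = u (fun _ : Fin 1 => p 0)} = 0 := by
  have h := KZ.volume_graph_eq_zero hu
  simpa only [init_eq, show (Fin.last 1) = (1 : Fin 2) from rfl] using h

/-- An open band lies in the cylinder over its base. [folklore] -/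
theorem band_subset_cyl (P : Set (Fin 1 → ℝ)) (a b : (Fin 1 → ℝ) → ℝ) :
    {p : Fin 2 → ℝ | (fun _ : Fin 1 => p 0) ∈ P ∧ a (fun _ : Fin 1 => p 0) < p 1 ∧
      p 1 < b (fun _ : Fin 1 => p 0)} ⊆ {p : Fin 2 → ℝ | (fun _ : Fin 1 => p 0) ∈ P} :=
  fun _ hp => hp.1

/-- An open band over a subset of the base is the part of the band inside the cylinder over it.
[folklore] -/
theorem band_inter_cyl {P Q : Set (Fin 1 → ℝ)} (hQP : Q ⊆ P) (a b : (Fin 1 → ℝ) → ℝ) :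
    {p : Fin 2 → ℝ | (fun _ : Fin 1 => p 0) ∈ P ∧ a (fun _ : Fin 1 => p 0) < p 1 ∧
      p 1 < b (fun _ : Fin 1 => p 0)} ∩ {p : Fin 2 → ℝ | (fun _ : Fin 1 => p 0) ∈ Q} =
    {p : Fin 2 → ℝ | (fun _ : Fin 1 => p 0) ∈ Q ∧ a (fun _ : Fin 1 => p 0) < p 1 ∧
      p 1 < b (fun _ : Fin 1 => p 0)} := by
  ext p
  simp only [mem_inter_iff, mem_setOf_eq]
  exact ⟨fun h => ⟨h.2, h.1.2⟩, fun h => ⟨⟨hQP h.1, h.2⟩, h.1⟩⟩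

/-- **Restricting a band to a sub-base**: an integrand-`1` representation on a band over `P`
restricts to one on the band over a `ℚ`-semialgebraic `Q ⊆ P`. [folklore] -/
theorem exists_restrict_band (r : KZ.IntegralRep 2) (hr : ∀ p ∈ r.domain, r.integrand p = 1)
    {P Q : Set (Fin 1 → ℝ)} {a b : (Fin 1 → ℝ) → ℝ}
    (hrd : r.domain = {p : Fin 2 → ℝ | (fun _ : Fin 1 => p 0) ∈ P ∧ a (fun _ : Fin 1 => p 0) < p 1 ∧
      p 1 < b (fun _ : Fin 1 => p 0)}) (hQ : IsSemialgebraic ℚ Q) (hQP : Q ⊆ P) :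
    ∃ r' : KZ.IntegralRep 2, r'.domain = {p : Fin 2 → ℝ | (fun _ : Fin 1 => p 0) ∈ Q ∧
      a (fun _ : Fin 1 => p 0) < p 1 ∧ p 1 < b (fun _ : Fin 1 => p 0)} ∧
      (∀ p ∈ r'.domain, r'.integrand p = 1) ∧ r'.domain ⊆ r.domain := by
  have hS : IsSemialgebraic ℚ (r.domain ∩ {p : Fin 2 → ℝ | (fun _ : Fin 1 => p 0) ∈ Q}) :=
    r.isSemialgebraic_domain.inter (isSemialgebraic_cyl hQ)
  refine ⟨r.restrict _ hS inter_subset_left, ?_, restrict_one r hr _ hS inter_subset_left,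
    inter_subset_left⟩
  rw [KZ.IntegralRep.domain_restrict, hrd, band_inter_cyl hQP]

/-- **Vertical cut to a co-null sub-base**: an integrand-`1` representation on the open subgraph of
`f` over `P` is congruent modulo `G` to an integrand-`1` representation on the open subgraph over a
`ℚ`-semialgebraic `Q ⊆ P` with `P \ Q` null. [Kontsevich–Zagier 2001, §1.2, rule (1)] -/
theorem exists_restrict_cell (r : KZ.IntegralRep 2) (hr : ∀ p ∈ r.domain, r.integrand p = 1)
    {P Q : Set (Fin 1 → ℝ)} {f : (Fin 1 → ℝ) → ℝ}
    (hrd : r.domain = {p : Fin 2 → ℝ | (fun _ : Fin 1 => p 0) ∈ P ∧ 0 < p 1 ∧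
      p 1 < f (fun _ : Fin 1 => p 0)}) (hQ : IsSemialgebraic ℚ Q) (hQP : Q ⊆ P)
    (h0 : volume (P \ Q) = 0) :
    ∃ r' : KZ.IntegralRep 2, r'.domain = {p : Fin 2 → ℝ | (fun _ : Fin 1 => p 0) ∈ Q ∧ 0 < p 1 ∧
      p 1 < f (fun _ : Fin 1 => p 0)} ∧ (∀ p ∈ r'.domain, r'.integrand p = 1) ∧
      KZ.of r - KZ.of r' ∈ planarGroup := by
  obtain ⟨r', hr'd, hr'1, hsub⟩ := exists_restrict_band r hr (a := fun _ => 0) (b := f) hrd hQ hQP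
  refine ⟨r', hr'd, hr'1, sub_mem_planarGroup_of_subset r r' hr hr'1 hsub ?_⟩
  refine volume_eq_zero_of_base h0 ?_
  rw [hrd, hr'd]
  rintro p ⟨⟨hx, h1, h2⟩, hp⟩
  exact ⟨hx, fun hxQ => hp ⟨hxQ, h1, h2⟩⟩

/-! ## §4 The line: finiteness of null sets, `1 × 1` determinants -/

/-- The unit vector of the line is the constant function `1`. [folklore] -/
theorem single_eq_one : (Pi.single (0 : Fin 1) (1 : ℝ) : Fin 1 → ℝ) = fun _ => 1 := by
  funext i
  fin_cases i
  simp

/-- **A null `ℚ`-semialgebraic subset of the line is finite** (it contains no interval;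
van den Dries 1998, Ch. 1 (3.2)). [folklore] -/
theorem finite_of_volume_eq_zero {E : Set (Fin 1 → ℝ)} (hE : IsSemialgebraic ℚ E)
    (h0 : volume E = 0) : E.Finite := by
  set A : Set ℝ := {t | (fun _ : Fin 1 => t) ∈ E} with hA
  have hEA : {z : Fin 1 → ℝ | z 0 ∈ A} = E := by
    ext z
    simp only [mem_setOf_eq, hA]
    rw [← KZ.eq_const_apply_zero z]
  have hAs : IsSemialgebraic ℝ {z : Fin 1 → ℝ | z 0 ∈ A} := by
    rw [hEA]; exact SemialgebraicMonotonicity.isSemialgebraic_real_of hE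
  have hAfin : A.Finite := by
    refine SemialgebraicMonotonicity.finite_of_forall_not_Ioo_subset hAs fun p q hpq hsub => ?_
    have hbox : {z : Fin 1 → ℝ | z 0 ∈ Ioo p q} ⊆ E := fun z hz => by
      rw [← hEA]; exact hsub hz
    have hpos : 0 < volume {z : Fin 1 → ℝ | z 0 ∈ Ioo p q} :=
      (isOpen_Ioo.preimage (continuous_apply 0)).measure_pos volume
        ⟨fun _ => (p + q) / 2, by show (p + q) / 2 ∈ Ioo p q; exact ⟨by linarith, by linarith⟩⟩
    exact absurd (measure_mono_null hbox h0) hpos.ne'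
  have : E = (fun t : ℝ => (fun _ : Fin 1 => t)) '' A := by
    ext z
    simp only [mem_image, mem_setOf_eq, hA]
    constructor
    · intro hz
      exact ⟨z 0, by rw [← KZ.eq_const_apply_zero z]; exact hz, (KZ.eq_const_apply_zero z).symm⟩
    · rintro ⟨t, ht, rfl⟩
      exact ht
  rw [this]
  exact hAfin.image _

/-- The determinant of a linear endomorphism of the line is its matrix entry. [folklore] -/
theorem det_eq_apply (L : (Fin 1 → ℝ) →L[ℝ] (Fin 1 → ℝ)) : L.det = L (Pi.single 0 1) 0 := by
  have h := LinearMap.det_toMatrix' (L : (Fin 1 → ℝ) →ₗ[ℝ] (Fin 1 → ℝ))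
  rw [Matrix.det_fin_one, LinearMap.toMatrix'_apply] at h
  exact h.symm

end Summit.KontsevichZagierPeriods.SymplecticScissors.PlanarCompilerProof.ElementaryMoves

namespace Summit.KontsevichZagierPeriods.SymplecticScissors.PlanarCompilerProof

/-- **Registered sub-goal of `stub_elementaryMoves` (file I): null modifications.** Two
integrand-`1` planar representations whose domains differ by null sets are congruent modulo the
planar set-chain group. [Kontsevich–Zagier 2001, §1.2, rule (1)] -/
theorem stub_elementaryMoves_nullModification : ∀ (r r' : KZ.IntegralRep 2), (∀ p ∈ r.domain, r.integrand p = 1) → (∀ p ∈ r'.domain, r'.integrand p = 1) → MeasureTheory.volume (r.domain \ r'.domain) = 0 → MeasureTheory.volume (r'.domain \ r.domain) = 0 → KZ.of r - KZ.of r' ∈ AddSubgroup.closure ((KZ.domainAddRel ∪ KZ.changeOfVariablesRel) ∩ (AddSubgroup.closure {x : KZ.FormalRep | ∃ s : KZ.IntegralRep 2, (∀ p ∈ s.domain, s.integrand p = 1) ∧ x = KZ.of s} : Set KZ.FormalRep)) :=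
  fun r r' hr hr' h₁ h₂ => ElementaryMoves.sub_mem_planarGroup_of_null r r' hr hr' h₁ h₂

end Summit.KontsevichZagierPeriods.SymplecticScissors.PlanarCompilerProof
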